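import Summits.BirchSwinnertonDyer.BirchSwinnertonDyer.Theorems.EisensteinPrimesBSDpOnCellCTelescopeK2PurityOfNoPseudoNull
import Summits.BirchSwinnertonDyer.BirchSwinnertonDyer.Theorems.EisensteinPrimesBSDpOnCellCTelescopeK2TorsionSelmerCofinite
import Literature.NumberTheory.EllipticCurves.HeegnerCharIdealEnvelopePowTransferProofs
import HarnessLib

/-!
# Crux 4 `BSDpOnCellC` (stmt-BirchSwinnertonDyer-19034), line «telescope», sub-leaf W4 (PURITY) of leaf N2 —
# the `p`-TOLERANT form of «route G»: purity of the `π`-torsion when every pseudo-null submodule is killed by a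
# power of `p` (pure commutative algebra; ideator bsd-idea-12 g38; `--supports`, helper; closes nothing)

Context. The LEAD's `TelescopeK2PurityOfNoPseudoNull` (cruxlead-19034 g2) proves sub-leaf W4 of the weight-two leaf
N2 (`K2Weight2.stub_weightTwoPurity` of the workfile `Cruxes/BSDpOnCellC/Lines/telescopeK2weight2.lean`:
`∃ m, (C (p^m)) ⊆ char_{ℤ_p⟦T⟧}(X₂[C X])` for the big dual Selmer module `X₂` over `B = ℤ_p⟦X⟧⟦T⟧`) with `m = 0`
from the STRICT input «every pseudo-null `B`-submodule of `X₂` is `⊥`» (Greenberg 2016 Prop. 4.1.1 (c)) plus the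
regular annihilator (reg₀). The strict input asks, through Prop. 4.1.1's hypothesis «`𝓛` is almost divisible», that
the unramified local conditions `H¹_ur(K_w, M₂)` at the primes `w ∣ N` be almost divisible (memo `W-PRICING-n2.md`
§W4-G, (G5-w)); when one of them is not, the dual Selmer module of `𝓛` contains the (pseudo-null, `p`-power torsion)
dual of `⊕_w L_w/L_{w,div}` and the strict input FAILS, while W4 — which carries a `p^m` slack — survives. This file is
the algebra of the `p`-TOLERANT input «every pseudo-null `B`-submodule of `X₂` is killed by a power of `p`»:

* §1 `forall_isPseudoNull_exists_pow_smul_eq_zero_of_eq_bot` — strict ⇒ tolerant (exponent `0`);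
  `forall_isPseudoNull_pow_smul_eq_zero_of_quotient` — the EXTENSION PRINCIPLE that makes the tolerant form the
  right research node: if `K ≤ M` is killed by `c^a` and `M ⧸ K` has no non-zero pseudo-null submodule, then every
  pseudo-null submodule of `M` is killed by `c^a` (its image in `M ⧸ K` is pseudo-null, hence zero) — the shape
  `K = ` dual of `S_𝓛/S_{𝓛_div} ↪ ⊕_w L_w/L_{w,div}`, `M ⧸ K = S_{𝓛_div}^∨` (Prop. 4.1.1 for the almost-divisible core);
* §2 `exists_pow_smul_torsionBy_eq_zero` — with a prime `π` and a killing `s`, `π ∤ s`, the `π`-torsion `M[π]` is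
  pseudo-null (the LEAD's `isPseudoNull_torsionBy_of_prime_of_not_dvd`), hence killed by some `c^m`;
* §3 `exists_span_pow_le_charIdeal_torsionBy_of_pTolerant` — for a coefficient ring `Λ → B` (Noetherian factorial
  domain) acting compatibly, `a ∈ Λ ∖ 0` mapping to `c`, and `M[π]` finitely generated over `Λ`: `(a^n) ⊆ char_Λ(M[π])`
  for some `n` (`Module.exists_span_pow_le_charIdeal_of_isTorsionBy`, Washington §13.2 shape);
* §4 the two-variable instance in W4's OWN SHAPE, `B = ℤ_p⟦X⟧⟦T⟧`, `π = C X`, `Λ = ℤ_p⟦T⟧` (Mathlib's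
  `PowerSeries.algebraPowerSeries`, `T ↦ T`), `c = p`, `a = C p`: `exists_span_C_pow_le_charIdeal_torsionBy_CX_of_pTolerant`
  — from «`p`-tolerant no-pseudo-null» + (reg₀) + `Module.Finite B N` (W1, the tree's `TelescopeK2WeightTwoFg.bigModuleFinite`)
  to `∃ m, (C (p^m)) ⊆ char_{ℤ_p⟦T⟧}(N[C X])`; finite generation over `ℤ_p⟦T⟧` of `N[C X]` is the tree's change of rings
  `TelescopeK2TorsionSelmerCofinite.module_finite_powerSeries_of_twoVar` (p751472).

So W4 ⟸ «`p`-tolerant no-pseudo-null for `X₂`» ∧ (reg₀) ∧ (fg), and the tolerant input follows from Prop. 4.1.1 applied to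
the almost-divisible core `𝓛_div` of the local conditions together with a `p`-power bound on `⊕_{w ∣ N} L_w/L_{w,div}` (§1).

HONEST FRAMING: commutative algebra over binders; nothing about any curve, newform or `L`-function is asserted; no
summit statement, no stub, no crux is proved; BSD is proved for no curve; 0 cells / labels / tiers move. THEOREMS ONLY
(no definition, no named fact, no `sorry`, no instance, no notation).

## References
[cite: BourbakiAC5to7, Ch. VII §4 no. 4 Def. 2, no. 5] [cite: Greenberg2016Selmer, §1 p. 2, Prop. 4.1.1 (c), §4.2 p. 19 L25–31]
[cite: Washington1997, §13.2] [cite: Ochiai2006, Prop. 8.1 (shape only)]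
-/

set_option autoImplicit false
-- D-0017: single-problem summit, the namespace repeats the problem name by design.
set_option linter.dupNamespace false

noncomputable section

namespace Summit.BirchSwinnertonDyer.BirchSwinnertonDyer.Theorems.TelescopeK2PurityOfPTorsionPseudoNull

open Literature.NumberTheory.EllipticCurves

variable {B : Type*} [CommRing B] {M : Type*} [AddCommGroup M] [Module B M]

/-! ## §1 «`c`-tolerant no-pseudo-null»: strict ⇒ tolerant, and the extension principle -/

/-- **Strict ⇒ tolerant.** If every pseudo-null `B`-submodule of `M` is `⊥`, then every pseudo-null submodule is
killed by `c^m` for some `m` (namely `m = 0`). [cite: Greenberg2016Selmer, §1 p. 2] -/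
theorem forall_isPseudoNull_exists_pow_smul_eq_zero_of_eq_bot (c : B)
    (hN : ∀ P : Submodule B M, Module.IsPseudoNull B ↥P → P = ⊥) :
    ∀ P : Submodule B M, Module.IsPseudoNull B ↥P → ∃ m : ℕ, ∀ x ∈ P, c ^ m • x = 0 := by
  intro P hP
  refine ⟨0, fun x hx => ?_⟩
  rw [hN P hP] at hx
  rw [(Submodule.mem_bot B).mp hx, smul_zero]

/-- **Extension principle.** If a submodule `K ≤ M` is killed by `c^a` and the quotient `M ⧸ K` has no non-zero
pseudo-null `B`-submodule, then EVERY pseudo-null submodule `P ≤ M` is killed by `c^a`: the image of `P` in `M ⧸ K`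
is pseudo-null (a quotient of a pseudo-null module), hence `⊥`, so `P ≤ K`. [cite: BourbakiAC5to7, Ch. VII §4 no. 4]
[cite: Greenberg2016Selmer, §4.2 p. 19 L25–31 (shape: `S_𝓛 / S_{𝓛'}` controlled by the local quotients)] -/
theorem forall_isPseudoNull_pow_smul_eq_zero_of_quotient (K : Submodule B M) {c : B} {a : ℕ}
    (hK : ∀ x ∈ K, c ^ a • x = 0)
    (hQ : ∀ P : Submodule B (M ⧸ K), Module.IsPseudoNull B ↥P → P = ⊥) :
    ∀ P : Submodule B M, Module.IsPseudoNull B ↥P → ∀ x ∈ P, c ^ a • x = 0 := by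
  intro P hP x hx
  have himg : Module.IsPseudoNull B ↥(P.map K.mkQ) := by
    refine hP.of_surjective
      (LinearMap.codRestrict (P.map K.mkQ) (K.mkQ.domRestrict P) fun y => Submodule.mem_map_of_mem y.2) ?_
    rintro ⟨z, hz⟩
    obtain ⟨y, hy, rfl⟩ := Submodule.mem_map.mp hz
    exact ⟨⟨y, hy⟩, Subtype.ext rfl⟩
  have hbot := hQ _ himg
  have hxK : x ∈ K := by
    have hmem : K.mkQ x ∈ P.map K.mkQ := Submodule.mem_map_of_mem hx
    rw [hbot, Submodule.mem_bot, Submodule.mkQ_apply, Submodule.Quotient.mk_eq_zero] at hmem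
    exact hmem
  exact hK x hxK

/-- The extension principle in the tolerant shape (`∃ m` per submodule). [cite: BourbakiAC5to7, Ch. VII §4 no. 4] -/
theorem forall_isPseudoNull_exists_pow_smul_eq_zero_of_quotient (K : Submodule B M) {c : B} {a : ℕ}
    (hK : ∀ x ∈ K, c ^ a • x = 0)
    (hQ : ∀ P : Submodule B (M ⧸ K), Module.IsPseudoNull B ↥P → P = ⊥) :
    ∀ P : Submodule B M, Module.IsPseudoNull B ↥P → ∃ m : ℕ, ∀ x ∈ P, c ^ m • x = 0 :=
  fun P hP => ⟨a, forall_isPseudoNull_pow_smul_eq_zero_of_quotient K hK hQ P hP⟩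

/-! ## §2 The `π`-torsion is killed by a power of `c` -/

/-- **`c^m` kills `M[π]`** when `π` is prime, some `s` with `π ∤ s` kills `M` (so `M[π]` is pseudo-null over the
Noetherian domain `B`: the LEAD's `TelescopeK2PurityOfNoPseudoNull.isPseudoNull_torsionBy_of_prime_of_not_dvd`) and every
pseudo-null submodule of `M` is killed by a power of `c`. [cite: BourbakiAC5to7, Ch. VII §4 no. 4 Def. 2] -/
theorem exists_pow_smul_torsionBy_eq_zero [IsNoetherianRing B] [IsDomain B] {π s : B} (c : B) (hπ : Prime π)
    (hs : ¬ π ∣ s) (hsM : ∀ m : M, s • m = 0)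
    (hN : ∀ P : Submodule B M, Module.IsPseudoNull B ↥P → ∃ m : ℕ, ∀ x ∈ P, c ^ m • x = 0) :
    ∃ m : ℕ, ∀ x ∈ Submodule.torsionBy B M π, c ^ m • x = 0 :=
  hN _ (TelescopeK2PurityOfNoPseudoNull.isPseudoNull_torsionBy_of_prime_of_not_dvd hπ hs hsM)

/-! ## §3 … hence `(a^n) ⊆ char_Λ(M[π])` for a coefficient ring `Λ` with `a ↦ c` -/

/-- **Purity from «`c`-tolerant no-pseudo-null»**: for a Noetherian factorial domain `Λ` mapping to `B` and acting on
`M` compatibly, `a ∈ Λ`, `a ≠ 0`, `a ↦ c`, and `M[π]` finitely generated over `Λ`: some `c^m` kills `M[π]` (§2), so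
`M[π]` is an `a^m`-torsion `Λ`-module and `((a^m)^n) ⊆ char_Λ(M[π])` (`Module.exists_span_pow_le_charIdeal_of_isTorsionBy`).
[cite: Washington1997, §13.2] [cite: BourbakiAC5to7, Ch. VII §4 no. 5] -/
theorem exists_span_pow_le_charIdeal_torsionBy_of_pTolerant [IsNoetherianRing B] [IsDomain B]
    {Λ : Type*} [CommRing Λ] [IsNoetherianRing Λ] [IsDomain Λ] [UniqueFactorizationMonoid Λ]
    [Algebra Λ B] [Module Λ M] [IsScalarTower Λ B M]
    {π s : B} {c : B} (hπ : Prime π) (hs : ¬ π ∣ s) (hsM : ∀ m : M, s • m = 0)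
    (hN : ∀ P : Submodule B M, Module.IsPseudoNull B ↥P → ∃ m : ℕ, ∀ x ∈ P, c ^ m • x = 0)
    {a : Λ} (ha : a ≠ 0) (hac : algebraMap Λ B a = c)
    [Module.Finite Λ ↥(Submodule.torsionBy B M π)] :
    ∃ n : ℕ, Ideal.span {a ^ n} ≤ Module.charIdeal Λ ↥(Submodule.torsionBy B M π) := by
  obtain ⟨m, hm⟩ := exists_pow_smul_torsionBy_eq_zero c hπ hs hsM hN
  have htor : Module.IsTorsionBy Λ ↥(Submodule.torsionBy B M π) (a ^ m) := by
    intro x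
    refine Subtype.ext ?_
    rw [Submodule.coe_smul_of_tower, Submodule.coe_zero, ← algebraMap_smul B (a ^ m) (x : M), map_pow, hac]
    exact hm x x.2
  obtain ⟨n, hn⟩ := Module.exists_span_pow_le_charIdeal_of_isTorsionBy (pow_ne_zero m ha) htor
  exact ⟨m * n, by rwa [pow_mul]⟩

/-! ## §4 The two-variable instance: `B = ℤ_p⟦X⟧⟦T⟧`, `π = C X`, `Λ = ℤ_p⟦T⟧`, `c = p`, `a = C p` (W4's shape) -/

/-- **W4's conclusion from «`p`-tolerant no-pseudo-null» + (reg₀) + (fg)**, for an arbitrary finitely generated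
`ℤ_p⟦X⟧⟦T⟧`-module `N` with a compatible `ℤ_p⟦T⟧`-structure (Mathlib's `PowerSeries.algebraPowerSeries`, `T ↦ T`;
this is how `XBig κ ρ₂ 𝔭̄ ∅` enters `K2Weight2.stub_weightTwoPurity`, `Module.Finite` being W1 =
`TelescopeK2WeightTwoFg.bigModuleFinite`): if every pseudo-null `ℤ_p⟦X⟧⟦T⟧`-submodule of `N` is killed by a power of `p`
and some `s` with `C X ∤ s` kills `N`, then `(C (p^m)) ⊆ char_{ℤ_p⟦T⟧}(N[C X])` for some `m`. The `C X`-torsion is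
finitely generated over `ℤ_p⟦T⟧` by the tree's change of rings `TelescopeK2TorsionSelmerCofinite.module_finite_powerSeries_of_twoVar`.
[cite: Greenberg2016Selmer, Prop. 4.1.1 (c) (shape only)] [cite: Washington1997, §13.2] -/
theorem exists_span_C_pow_le_charIdeal_torsionBy_CX_of_pTolerant {p : ℕ} [Fact p.Prime]
    {N : Type*} [AddCommGroup N] [Module (PowerSeries (PowerSeries ℤ_[p])) N]
    [Module.Finite (PowerSeries (PowerSeries ℤ_[p])) N]
    [Module (PowerSeries ℤ_[p]) N]
    [IsScalarTower (PowerSeries ℤ_[p]) (PowerSeries (PowerSeries ℤ_[p])) N]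
    (hN : ∀ P : Submodule (PowerSeries (PowerSeries ℤ_[p])) N,
      Module.IsPseudoNull (PowerSeries (PowerSeries ℤ_[p])) ↥P →
        ∃ m : ℕ, ∀ x ∈ P, (p : PowerSeries (PowerSeries ℤ_[p])) ^ m • x = 0)
    (hreg : ∃ s : PowerSeries (PowerSeries ℤ_[p]),
      ¬ (PowerSeries.C (PowerSeries.X : PowerSeries ℤ_[p]) ∣ s) ∧ ∀ m : N, s • m = 0) :
    ∃ m : ℕ, Ideal.span {PowerSeries.C ((p : ℤ_[p]) ^ m)} ≤
      Module.charIdeal (PowerSeries ℤ_[p])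
        ↥(Submodule.torsionBy (PowerSeries (PowerSeries ℤ_[p])) N
          (PowerSeries.C (PowerSeries.X : PowerSeries ℤ_[p]))) := by
  obtain ⟨s, hs, hsN⟩ := hreg
  haveI : IsNoetherian (PowerSeries (PowerSeries ℤ_[p])) N := isNoetherian_of_isNoetherianRing_of_finite _ _
  haveI : Module.Finite (PowerSeries ℤ_[p])
      ↥(Submodule.torsionBy (PowerSeries (PowerSeries ℤ_[p])) N
        (PowerSeries.C (PowerSeries.X : PowerSeries ℤ_[p]))) :=
    TelescopeK2TorsionSelmerCofinite.module_finite_powerSeries_of_twoVar fun y =>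
      Subtype.ext (by
        rw [Submodule.coe_smul, Submodule.coe_zero]
        exact (Submodule.mem_torsionBy_iff _ _).mp y.2)
  have hp0 : (PowerSeries.C (p : ℤ_[p]) : PowerSeries ℤ_[p]) ≠ 0 := by
    intro h
    have h1 := congrArg (PowerSeries.constantCoeff (R := ℤ_[p])) h
    rw [PowerSeries.constantCoeff_C, map_zero] at h1
    exact (Nat.cast_ne_zero.mpr (Fact.out : p.Prime).ne_zero) h1
  have hac : algebraMap (PowerSeries ℤ_[p]) (PowerSeries (PowerSeries ℤ_[p])) (PowerSeries.C (p : ℤ_[p])) =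
      (p : PowerSeries (PowerSeries ℤ_[p])) := by
    rw [map_natCast, map_natCast]
  obtain ⟨n, hn⟩ := exists_span_pow_le_charIdeal_torsionBy_of_pTolerant
    TelescopeK2PurityOfNoPseudoNull.prime_C_X hs hsN hN hp0 hac
  exact ⟨n, by rwa [← map_pow] at hn⟩

/-- **The strict instance recovered** (cross-check with the LEAD's `exists_span_C_pow_le_charIdeal_torsionBy_CX`, now
through the tolerant route): «every pseudo-null submodule is `⊥`» + (reg₀) + (fg) ⇒ W4's conclusion.
[cite: Greenberg2016Selmer, Prop. 4.1.1 (c) (shape only)] -/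
theorem exists_span_C_pow_le_charIdeal_torsionBy_CX_of_eq_bot {p : ℕ} [Fact p.Prime]
    {N : Type*} [AddCommGroup N] [Module (PowerSeries (PowerSeries ℤ_[p])) N]
    [Module.Finite (PowerSeries (PowerSeries ℤ_[p])) N]
    [Module (PowerSeries ℤ_[p]) N]
    [IsScalarTower (PowerSeries ℤ_[p]) (PowerSeries (PowerSeries ℤ_[p])) N]
    (hN : ∀ P : Submodule (PowerSeries (PowerSeries ℤ_[p])) N,
      Module.IsPseudoNull (PowerSeries (PowerSeries ℤ_[p])) ↥P → P = ⊥)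
    (hreg : ∃ s : PowerSeries (PowerSeries ℤ_[p]),
      ¬ (PowerSeries.C (PowerSeries.X : PowerSeries ℤ_[p]) ∣ s) ∧ ∀ m : N, s • m = 0) :
    ∃ m : ℕ, Ideal.span {PowerSeries.C ((p : ℤ_[p]) ^ m)} ≤
      Module.charIdeal (PowerSeries ℤ_[p])
        ↥(Submodule.torsionBy (PowerSeries (PowerSeries ℤ_[p])) N
          (PowerSeries.C (PowerSeries.X : PowerSeries ℤ_[p]))) :=
  exists_span_C_pow_le_charIdeal_torsionBy_CX_of_pTolerant
    (forall_isPseudoNull_exists_pow_smul_eq_zero_of_eq_bot _ hN) hreg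

end Summit.BirchSwinnertonDyer.BirchSwinnertonDyer.Theorems.TelescopeK2PurityOfPTorsionPseudoNull

end
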